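import Summits.AtomisticToContinuum.FouriersLaw.Theorems.BondHeatUncertaintyLightConeBondHeatBathBondTransfer
import Summits.AtomisticToContinuum.FouriersLaw.Theorems.BoundaryEscapeDeficitBoundaryKernelBasics

/-!
# `LightConeBondHeat` from the half-line boundary tail law plus light-cone locality

Support file for item `stmt-AtomisticToContinuum-9123` (`BondHeatUncertainty.LightConeBondHeat`, (S_lc): the `N`-uniform
law `V_N(b,t) ≤ A√t` on the LIGHT-CONE window `1 ≤ t ≤ a·N` for the equilibrium bond-heat variance of one bond of the
pinned anharmonic chain).  The landed bath-bond transfer (`…LightConeBondHeatBathBondTransfer`,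
`lightConeBondHeat_of_lightConeDeficitUpperTail`) pins (S_lc) to the light-cone pointwise tail of the boundary deficit
curve, `1 − θ_N(s) ≤ C/√s` for `1 ≤ s ≤ a·N`, `θ_N(s) = (γ/T²)∫₀ˢ K_N`, `K_N(u) = ⟨p₀² − T, P_u(p₀² − T)⟩_{μ_T}` (VERBATIM
the `let K`, `let θ` of route `BoundaryEscapeDeficit`).  This file records what separates that light-cone tail from the
EXISTING crux `BoundaryEscapeDeficit.HalfChainTailLaw` (stmt-AtomisticToContinuum-12235: `c/√t ≤ 1 − θ_M(t) ≤ C/√t` for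
`t ≥ t₀`, EVENTUALLY in the length `M`, with no rate): exactly a LIGHT-CONE LOCALITY estimate with a rate,
`|∫₀ᵗ K_N − ∫₀ᵗ K_M| ≤ C_loc/√t` whenever `v·t ≤ N ≤ M` (the quantitative form of the support item `HalfChainLocality`,
stmt-AtomisticToContinuum-12240: inside the cone the boundary autocorrelation of the `N`-chain does not see the far bath).

* `lightConeTail_of_eventually_of_locality` — the abstract real/filter bookkeeping: an upper tail bound holding
  eventually in `M` at each fixed `t ≥ t₀`, a locality estimate coupling lengths `N ≤ M` for `v·t ≤ N`, and an a-priori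
  bound on `[1, t₀]` give the tail bound for EVERY `N` on the whole light-cone window `1 ≤ s ≤ N/v`;
* `lightConeBondHeat_of_halfChainUpperTail_of_locality` — (S_lc) from the UPPER half-line tail law (spelled out) and
  light-cone locality (the a-priori bound `1 − θ_N(t) ≤ 1 + 2γt` comes from the landed `|K_N| ≤ 2T²`,
  `BoundaryKernelBasics` (c), stmt-AtomisticToContinuum-12239);
* `lightConeBondHeat_of_halfChainTailLaw_of_locality` — the same with `HalfChainTailLaw` BY NAME.

So, modulo light-cone locality, (S_lc) hinges on the upper half of crux 12235 ALONE — unlike (S) `SubdiffusiveBondHeat`,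
whose Thouless window `t ≤ cN²` lies beyond every light cone and needs the finite-`N` deficit curve itself
(`DeficitCesaroEW`, the promoted stub of crux stmt-AtomisticToContinuum-9120).  Both hypotheses here are `N`-uniform
dynamical statements about a deterministic anharmonic bulk and are OPEN (BLR2000 §6.3; ButtaEtAl2007 for the locality
technology); nothing in this file closes an item.
-/

noncomputable section

open MeasureTheory Filter Topology Set
open Literature.MathematicalPhysics.KineticTheory.HeatConduction

namespace Summit.AtomisticToContinuum.FouriersLaw.Theorems.LightConeBondHeat

open Summit.AtomisticToContinuum.FouriersLaw.Theses.BondHeatUncertainty (LightConeBondHeat)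
open Summit.AtomisticToContinuum.FouriersLaw.Theses.BoundaryEscapeDeficit (HalfChainTailLaw)

/-! ### Abstract bookkeeping -/

/-- **Eventual tail bound + light-cone locality ⇒ tail bound on the light-cone window, for every length.**  If
`1 − θ_M(t) ≤ C/√t` eventually in `M` for each `t ≥ t₀`, if `|θ_N(t) − θ_M(t)| ≤ C_l/√t` whenever `1 ≤ t`, `v·t ≤ N ≤ M`
(`v > 0`), and if `1 − θ_N(t) ≤ B` for `1 ≤ t ≤ t₀`, then for every `N` and every `1 ≤ s ≤ N/v`,
`1 − θ_N(s) ≤ C'/√s` with `C' = max(C,0) + max(C_l,0) + max(B,0)·√(max(t₀,1))`.  (At `s ≥ t₀` pick one `M ≥ N` in the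
eventual set; at `s ≤ t₀` use `√s ≤ √(max(t₀,1))`.) [folklore] -/
theorem lightConeTail_of_eventually_of_locality {θ : ℕ → ℝ → ℝ} {C t₀ v Cl B : ℝ} (hv : 0 < v)
    (htail : ∀ t : ℝ, t₀ ≤ t → ∀ᶠ M : ℕ in atTop, 1 - θ M t ≤ C / Real.sqrt t)
    (hloc : ∀ (N M : ℕ) (t : ℝ), 1 ≤ t → v * t ≤ N → N ≤ M → |θ N t - θ M t| ≤ Cl / Real.sqrt t)
    (hshort : ∀ (N : ℕ) (t : ℝ), 1 ≤ t → t ≤ t₀ → 1 - θ N t ≤ B) :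
    ∀ (N : ℕ) (s : ℝ), 1 ≤ s → s ≤ 1 / v * (N : ℝ) →
      1 - θ N s ≤ (max C 0 + max Cl 0 + max B 0 * Real.sqrt (max t₀ 1)) / Real.sqrt s := by
  intro N s hs hsN
  have hs0 : 0 < s := lt_of_lt_of_le one_pos hs
  have hsq : 0 < Real.sqrt s := Real.sqrt_pos.2 hs0
  have hvs : v * s ≤ N := by
    have h := mul_le_mul_of_nonneg_left hsN hv.le
    rwa [← mul_assoc, mul_one_div_cancel hv.ne', one_mul] at h
  have hC : C / Real.sqrt s ≤ max C 0 / Real.sqrt s := div_le_div_of_nonneg_right (le_max_left _ _) hsq.le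
  have hCl : Cl / Real.sqrt s ≤ max Cl 0 / Real.sqrt s := div_le_div_of_nonneg_right (le_max_left _ _) hsq.le
  have hC0 : 0 ≤ max C 0 / Real.sqrt s := div_nonneg (le_max_right _ _) hsq.le
  have hCl0 : 0 ≤ max Cl 0 / Real.sqrt s := div_nonneg (le_max_right _ _) hsq.le
  have hB0 : 0 ≤ max B 0 * Real.sqrt (max t₀ 1) / Real.sqrt s :=
    div_nonneg (mul_nonneg (le_max_right _ _) (Real.sqrt_nonneg _)) hsq.le
  have hsplit : (max C 0 + max Cl 0 + max B 0 * Real.sqrt (max t₀ 1)) / Real.sqrt s =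
      max C 0 / Real.sqrt s + max Cl 0 / Real.sqrt s + max B 0 * Real.sqrt (max t₀ 1) / Real.sqrt s := by
    field_simp
  rw [hsplit]
  rcases le_or_gt t₀ s with hts | hst
  · -- long times: one `M ≥ N` in the eventual set at `s`
    obtain ⟨M, hM, hNM⟩ := ((htail s hts).and (eventually_ge_atTop N)).exists
    have hl := hloc N M s hs hvs hNM
    have habs : θ M s - θ N s ≤ Cl / Real.sqrt s := by
      have := neg_abs_le (θ N s - θ M s)
      linarith
    have : 1 - θ N s = (1 - θ M s) + (θ M s - θ N s) := by ring
    rw [this]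
    linarith
  · -- short times: the a-priori bound and `√s ≤ √(max t₀ 1)`
    have hb := hshort N s hs hst.le
    have hle1 : Real.sqrt s ≤ Real.sqrt (max t₀ 1) := Real.sqrt_le_sqrt (le_trans hst.le (le_max_left _ _))
    have hB : B ≤ max B 0 * Real.sqrt (max t₀ 1) / Real.sqrt s := by
      rw [le_div_iff₀ hsq]
      calc B * Real.sqrt s ≤ max B 0 * Real.sqrt s := mul_le_mul_of_nonneg_right (le_max_left _ _) hsq.le
        _ ≤ max B 0 * Real.sqrt (max t₀ 1) := mul_le_mul_of_nonneg_left hle1 (le_max_right _ _)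
    linarith

/-! ### (S_lc) from the half-line upper tail law and light-cone locality -/

/-- **`LightConeBondHeat` from the UPPER half-line boundary tail law and light-cone locality with a rate.**  Suppose that
for the pinned anharmonic chain (all parameters `> 0`) and every `T > 0`, with `K_N(u) = ⟨p₀² − T, P_u(p₀² − T)⟩_{μ_T}`
(VERBATIM the `let K` of route `BoundaryEscapeDeficit`):
(i) (upper half of `HalfChainTailLaw`, stmt-AtomisticToContinuum-12235) `∃ C t₀ ∀ t ≥ t₀`, eventually in `M`,
`1 − (γ/T²)∫₀ᵗ K_M ≤ C/√t`; (ii) (light-cone locality, the quantitative form of `HalfChainLocality`,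
stmt-AtomisticToContinuum-12240) `∃ v > 0, C_l ∀ N M t`, `1 ≤ t → v·t ≤ N → N ≤ M → |∫₀ᵗ K_N − ∫₀ᵗ K_M| ≤ C_l/√t`.
Then `LightConeBondHeat`.  Proof: `lightConeTail_of_eventually_of_locality` with the a-priori bound
`1 − (γ/T²)∫₀ᵗ K_N ≤ 1 + 2γt` (`|K_N| ≤ 2T²`, the landed `BoundaryKernelBasics` (c)) gives the light-cone pointwise tail
`1 − θ_N(s) ≤ C'/√s` on `1 ≤ s ≤ N/v` for every `N`, and `lightConeBondHeat_of_lightConeDeficitUpperTail` (landed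
bath-bond transfer, witness bond `b = 0`) concludes. [folklore] -/
theorem lightConeBondHeat_of_halfChainUpperTail_of_locality
    (hTail : ∀ ω₂ lam β γ : ℝ, 0 < ω₂ → 0 < lam → 0 < β → 0 < γ → ∀ T : ℝ, 0 < T → ∃ C t₀ : ℝ,
      ∀ t : ℝ, t₀ ≤ t → ∀ᶠ M : ℕ in atTop,
        1 - γ / T ^ 2 * (∫ u in (0 : ℝ)..t,
          if h : 0 < M then
            ∫ z, ((z.2 ⟨0, h⟩) ^ 2 - T) *
                (∫ y, ((y.2 ⟨0, h⟩) ^ 2 - T) ∂((pinnedChain ω₂ lam β γ).transitionKernel M T T u.toNNReal z))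
              ∂((pinnedChain ω₂ lam β γ).gibbsMeasure M T)
          else 0) ≤ C / Real.sqrt t)
    (hLoc : ∀ ω₂ lam β γ : ℝ, 0 < ω₂ → 0 < lam → 0 < β → 0 < γ → ∀ T : ℝ, 0 < T → ∃ v Cl : ℝ, 0 < v ∧
      ∀ (N M : ℕ) (t : ℝ), 1 ≤ t → v * t ≤ (N : ℝ) → N ≤ M →
        |(∫ u in (0 : ℝ)..t,
            if h : 0 < N then
              ∫ z, ((z.2 ⟨0, h⟩) ^ 2 - T) *
                  (∫ y, ((y.2 ⟨0, h⟩) ^ 2 - T) ∂((pinnedChain ω₂ lam β γ).transitionKernel N T T u.toNNReal z))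
                ∂((pinnedChain ω₂ lam β γ).gibbsMeasure N T)
            else 0) -
          (∫ u in (0 : ℝ)..t,
            if h : 0 < M then
              ∫ z, ((z.2 ⟨0, h⟩) ^ 2 - T) *
                  (∫ y, ((y.2 ⟨0, h⟩) ^ 2 - T) ∂((pinnedChain ω₂ lam β γ).transitionKernel M T T u.toNNReal z))
                ∂((pinnedChain ω₂ lam β γ).gibbsMeasure M T)
            else 0)| ≤ Cl / Real.sqrt t) :
    LightConeBondHeat := by
  refine lightConeBondHeat_of_lightConeDeficitUpperTail fun ω₂ lam β γ hω hl hβ hγ T hT => ?_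
  obtain ⟨C, t₀, hC⟩ := hTail ω₂ lam β γ hω hl hβ hγ T hT
  obtain ⟨v, Cl, hv, hCl⟩ := hLoc ω₂ lam β γ hω hl hβ hγ T hT
  -- the boundary autocorrelation of the `N`-chain, as a function of `(N, u)`
  set K : ℕ → ℝ → ℝ := fun N u =>
    if h : 0 < N then
      ∫ z, ((z.2 ⟨0, h⟩) ^ 2 - T) *
          (∫ y, ((y.2 ⟨0, h⟩) ^ 2 - T) ∂((pinnedChain ω₂ lam β γ).transitionKernel N T T u.toNNReal z))
        ∂((pinnedChain ω₂ lam β γ).gibbsMeasure N T)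
    else 0 with hK
  have hT2 : 0 < T ^ 2 := by positivity
  have hγT : 0 ≤ γ / T ^ 2 := div_nonneg hγ.le hT2.le
  -- (c) of `BoundaryKernelBasics`: `|K_N(u)| ≤ 2T²` (also at `N = 0`, where `K_0 = 0`)
  have hKabs : ∀ (N : ℕ) (u : ℝ), |K N u| ≤ 2 * T ^ 2 := by
    intro N u
    by_cases hN : 0 < N
    · have hb := SubdiffusiveBondHeat.boundaryKernelBasics_proof ω₂ lam β γ hω hl hβ hγ T hT N hN
      dsimp only at hb
      obtain ⟨-, -, habs, -, -⟩ := hb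
      have h := habs u
      simp only [hK]
      exact h
    · simp only [hK, dif_neg hN, abs_zero]
      positivity
  -- a priori: `1 − (γ/T²)∫₀ᵗ K_N ≤ 1 + 2γt`
  have hshort : ∀ (N : ℕ) (t : ℝ), 1 ≤ t → t ≤ max t₀ 1 →
      1 - γ / T ^ 2 * (∫ u in (0 : ℝ)..t, K N u) ≤ 1 + 2 * γ * max t₀ 1 := by
    intro N t ht1 htt
    have ht0 : 0 ≤ t := le_trans zero_le_one ht1
    have hint : ‖∫ u in (0 : ℝ)..t, K N u‖ ≤ 2 * T ^ 2 * |t - 0| :=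
      intervalIntegral.norm_integral_le_of_norm_le_const fun u _ => by
        rw [Real.norm_eq_abs]; exact hKabs N u
    rw [sub_zero, abs_of_nonneg ht0, Real.norm_eq_abs] at hint
    have h1 : -(∫ u in (0 : ℝ)..t, K N u) ≤ 2 * T ^ 2 * t := le_trans (neg_le_abs _) hint
    have h2 : -(γ / T ^ 2 * ∫ u in (0 : ℝ)..t, K N u) ≤ γ / T ^ 2 * (2 * T ^ 2 * t) := by
      rw [← mul_neg]; exact mul_le_mul_of_nonneg_left h1 hγT
    have h3 : γ / T ^ 2 * (2 * T ^ 2 * t) = 2 * γ * t := by field_simp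
    have h4 : 2 * γ * t ≤ 2 * γ * max t₀ 1 := mul_le_mul_of_nonneg_left htt (by positivity)
    linarith
  -- the eventual tail bound, restated for `t ≥ max t₀ 1`
  have htail : ∀ t : ℝ, max t₀ 1 ≤ t → ∀ᶠ M : ℕ in atTop,
      1 - γ / T ^ 2 * (∫ u in (0 : ℝ)..t, K M u) ≤ C / Real.sqrt t := fun t ht =>
    hC t (le_trans (le_max_left _ _) ht)
  -- locality for `θ = (γ/T²)∫K`
  have hloc : ∀ (N M : ℕ) (t : ℝ), 1 ≤ t → v * t ≤ N → N ≤ M →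
      |γ / T ^ 2 * (∫ u in (0 : ℝ)..t, K N u) - γ / T ^ 2 * (∫ u in (0 : ℝ)..t, K M u)| ≤
        γ / T ^ 2 * Cl / Real.sqrt t := by
    intro N M t ht hvt hNM
    have h := hCl N M t ht hvt hNM
    rw [← mul_sub, abs_mul, abs_of_nonneg hγT, mul_div_assoc]
    exact mul_le_mul_of_nonneg_left h hγT
  have key := lightConeTail_of_eventually_of_locality (θ := fun N t => γ / T ^ 2 * ∫ u in (0 : ℝ)..t, K N u)
    (B := 1 + 2 * γ * max t₀ 1) hv htail hloc hshort
  refine ⟨max C 0 + max (γ / T ^ 2 * Cl) 0 + max (1 + 2 * γ * max t₀ 1) 0 * Real.sqrt (max (max t₀ 1) 1),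
    1 / v, by positivity, 0, fun N _ s hs hsN => ?_⟩
  have h := key N s hs hsN
  simp only [hK] at h
  exact h

/-- **`LightConeBondHeat` from `HalfChainTailLaw` (by name) and light-cone locality with a rate.**  The crux
`BoundaryEscapeDeficit.HalfChainTailLaw` (stmt-AtomisticToContinuum-12235) supplies hypothesis (i) of
`lightConeBondHeat_of_halfChainUpperTail_of_locality` (only its UPPER bound is used); hypothesis (ii) is the
quantitative light-cone form of `BoundaryEscapeDeficit.HalfChainLocality` (stmt-AtomisticToContinuum-12240).  So, modulo
light-cone locality of the boundary autocorrelation, (S_lc) is a corollary of crux 12235 — without passing through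
(S) `SubdiffusiveBondHeat`, whose Thouless window no light cone contains. [folklore] -/
theorem lightConeBondHeat_of_halfChainTailLaw_of_locality (hT : HalfChainTailLaw)
    (hLoc : ∀ ω₂ lam β γ : ℝ, 0 < ω₂ → 0 < lam → 0 < β → 0 < γ → ∀ T : ℝ, 0 < T → ∃ v Cl : ℝ, 0 < v ∧
      ∀ (N M : ℕ) (t : ℝ), 1 ≤ t → v * t ≤ (N : ℝ) → N ≤ M →
        |(∫ u in (0 : ℝ)..t,
            if h : 0 < N then
              ∫ z, ((z.2 ⟨0, h⟩) ^ 2 - T) *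
                  (∫ y, ((y.2 ⟨0, h⟩) ^ 2 - T) ∂((pinnedChain ω₂ lam β γ).transitionKernel N T T u.toNNReal z))
                ∂((pinnedChain ω₂ lam β γ).gibbsMeasure N T)
            else 0) -
          (∫ u in (0 : ℝ)..t,
            if h : 0 < M then
              ∫ z, ((z.2 ⟨0, h⟩) ^ 2 - T) *
                  (∫ y, ((y.2 ⟨0, h⟩) ^ 2 - T) ∂((pinnedChain ω₂ lam β γ).transitionKernel M T T u.toNNReal z))
                ∂((pinnedChain ω₂ lam β γ).gibbsMeasure M T)
            else 0)| ≤ Cl / Real.sqrt t) :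
    LightConeBondHeat := by
  refine lightConeBondHeat_of_halfChainUpperTail_of_locality (fun ω₂ lam β γ hω hl hβ hγ T hT' => ?_) hLoc
  have h := hT ω₂ lam β γ hω hl hβ hγ T hT'
  dsimp only at h
  obtain ⟨c, C, t₀, -, -, htail⟩ := h
  exact ⟨C, t₀, fun t ht => (htail t ht).mono fun M hM => hM.2⟩

end Summit.AtomisticToContinuum.FouriersLaw.Theorems.LightConeBondHeat

end
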